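import Literature.NumberTheory.Rogawski1990.StabilizationSchema
import HarnessLib

/-!
# The elliptic stabilisation SUMMED over stable classes: `Σ_𝒪 J(𝒪, f′) = Σ_𝒪 SJ(𝒪, f) + i · Σ_{𝒪′} SJ_H(𝒪′, f^H)` from the class-by-class law
(Rogawski, *Automorphic representations of unitary groups in three variables* (1990), Thm. 14.5.1 (a) p. 238 ⇒ `J_{G′}(f′) = SJ_G(f) + ½ SJ_H(f′^H)`,
§14.5 pp. 240–241; §10.1 p. 146)

Topic `NumberTheory/Rogawski1990`; namespace `Literature.NumberTheory.Rogawski1990`.  THEOREMS ONLY (no definition, no named fact, no instance, no `sorry`);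
pure `finsum` algebra, sequel of ★ `StabilizationSchema` (T1b-7).  The floor-0 line `F0_T1InnerFormTraceIdentity` states T1b = `EllipticStabilisation` as a
conjunction: (1) class by class `J c f′ = SJG c f + ½ · Σᶠ_{c′ : transfersTo c′ c} SJH c′ f^H` and (2) summed `Σᶠ_c J c f′ = Σᶠ_c SJG c f + ½ · Σᶠ_{c′} SJH c′ f^H`.
Here: **(1) ⇒ (2)** whenever the transfer relation is the graph of a map `t : CH → CG` («every stable class of `H` transfers to exactly one stable class of
`G`», ★ `stableClassTransfer`, pinned as `transfersTo c′ c ↔ stableClassTransfer … c′ = c` in ED 1.19c) and the class functions `J`, `SJH` are finitely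
supported (the line's pins (viii⁗) and the finite-support clause of the SJ sockets):

* `finsum_finsum_subtype_eq_finsum_of_iff` — **`Σᶠ_c Σᶠ_{c′ : T c′ c} g c′ = Σᶠ_{c′} g c′`** for `T c′ c ↔ t c′ = c` and `g` finitely supported (regrouping
  a finite sum along the fibres of `t`);
* `finite_support_finsum_subtype_of_iff` — the fibre sums are finitely supported in `c`;
* **`finsum_eq_finsum_add_mul_finsum_of_forall_eq`** — from `∀ c, J c = S c + i · Σᶠ_{c′ : T c′ c} SJH c′` with `J`, `SJH` finitely supported:
  `Σᶠ_c J c = Σᶠ_c S c + i · Σᶠ_{c′} SJH c′`; and the `stabilize` reading `finsum_eq_finsum_stabilize_add_mul_finsum`.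

## References
* J. D. Rogawski, *Automorphic Representations of Unitary Groups in Three Variables*, Ann. of Math. Stud. 123 (1990), Thm. 14.5.1 (a) p. 238, §14.5
  pp. 240–241, §10.1 p. 146 [Rogawski1990].
-/

noncomputable section

namespace Literature.NumberTheory.Rogawski1990

section Summed

variable {CG CH : Type*} {M : Type*} [AddCommMonoid M]

/-- The fibre sum `Σᶠ_{c′ : T c′ c} g c′` over the graph relation of `t` is the `finsum` of `g` over the fibre `t ⁻¹' {c}`. [cite: Rogawski1990, §10.1 p. 146] -/
theorem finsum_subtype_eq_finsum_mem_preimage_of_iff (T : CH → CG → Prop) (t : CH → CG) (hT : ∀ c' c, T c' c ↔ t c' = c) (g : CH → M) (c : CG) :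
    ∑ᶠ c' : {c' : CH // T c' c}, g c'.1 = ∑ᶠ c' ∈ t ⁻¹' {c}, g c' := by
  rw [← finsum_set_coe_eq_finsum_mem]
  exact finsum_comp_equiv (Equiv.subtypeEquivProp (funext fun c' => propext (by rw [hT]; rfl)))
    (f := fun c' : (t ⁻¹' {c} : Set CH) => g c'.1)

/-- With `g` finitely supported, the fibre sum over `t ⁻¹' {c}` is the finite sum of `g` over the support points in the fibre. [cite: Rogawski1990, §10.1 p. 146] -/
theorem finsum_mem_preimage_eq_sum_filter [DecidableEq CG] (t : CH → CG) (g : CH → M) (hg : (Function.support g).Finite) (c : CG) :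
    ∑ᶠ c' ∈ t ⁻¹' {c}, g c' = ∑ c' ∈ hg.toFinset with t c' = c, g c' := by
  classical
  rw [finsum_mem_eq_sum_filter g _ (show Function.HasFiniteSupport g from hg)]
  refine Finset.sum_congr ?_ fun _ _ => rfl
  ext c'
  simp only [Finset.mem_filter, Set.Finite.mem_toFinset, Set.mem_preimage, Set.mem_singleton_iff]

/-- The fibre sums `c ↦ Σᶠ_{c′ ∈ t⁻¹'{c}} g c′` are supported on the (finite) image of the support of `g`. [cite: Rogawski1990, §10.1 p. 146] -/
theorem support_finsum_mem_preimage_subset [DecidableEq CG] (t : CH → CG) (g : CH → M) (hg : (Function.support g).Finite) :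
    (Function.support fun c => ∑ᶠ c' ∈ t ⁻¹' {c}, g c') ⊆ ↑(hg.toFinset.image t) := by
  intro c hc
  rw [Function.mem_support, finsum_mem_preimage_eq_sum_filter t g hg] at hc
  obtain ⟨c', hc', -⟩ := Finset.exists_ne_zero_of_sum_ne_zero hc
  rw [Finset.mem_filter] at hc'
  exact Finset.mem_coe.mpr (Finset.mem_image.mpr ⟨c', hc'.1, hc'.2⟩)

/-- … hence finitely supported. [cite: Rogawski1990, §10.1 p. 146] -/
theorem finite_support_finsum_subtype_of_iff (T : CH → CG → Prop) (t : CH → CG) (hT : ∀ c' c, T c' c ↔ t c' = c) (g : CH → M)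
    (hg : (Function.support g).Finite) : (Function.support fun c => ∑ᶠ c' : {c' : CH // T c' c}, g c'.1).Finite := by
  classical
  simp_rw [finsum_subtype_eq_finsum_mem_preimage_of_iff T t hT]
  exact (Finset.finite_toSet _).subset (support_finsum_mem_preimage_subset t g hg)

/-- **Regrouping along the fibres of `t`: `Σᶠ_c Σᶠ_{c′ : T c′ c} g c′ = Σᶠ_{c′} g c′`** for the graph relation `T c′ c ↔ t c′ = c` and `g` finitely supported
— «the sum over the stable classes `𝒪′` of `H` which transfer to `𝒪`», then summed over `𝒪`, is the sum over all `𝒪′`. [cite: Rogawski1990, §14.5 pp. 240–241] -/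
theorem finsum_finsum_subtype_eq_finsum_of_iff (T : CH → CG → Prop) (t : CH → CG) (hT : ∀ c' c, T c' c ↔ t c' = c) (g : CH → M)
    (hg : (Function.support g).Finite) : ∑ᶠ c, ∑ᶠ c' : {c' : CH // T c' c}, g c'.1 = ∑ᶠ c', g c' := by
  classical
  simp_rw [finsum_subtype_eq_finsum_mem_preimage_of_iff T t hT]
  rw [finsum_eq_sum_of_support_subset _ (support_finsum_mem_preimage_subset t g hg),
    finsum_eq_sum_of_support_subset g (by rw [hg.coe_toFinset])]
  simp_rw [finsum_mem_preimage_eq_sum_filter t g hg]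
  exact Finset.sum_fiberwise_of_maps_to (fun c' hc' => Finset.mem_image_of_mem _ hc') g

end Summed

section Law

variable {CG CH : Type*} {R : Type*} [CommRing R]

/-- **The class-by-class law implies the summed law**: if `J c = S c + i · Σᶠ_{c′ : T c′ c} SJH c′` for every `c`, with `T` the graph of `t`, and `J`, `SJH` are
finitely supported, then `Σᶠ_c J c = Σᶠ_c S c + i · Σᶠ_{c′} SJH c′` — [Thm. 14.5.1 (a)] ⇒ «`J_{G′}(f′) = SJ_G(f) + ½ SJ_H(f′^H)`», the second conjunct of the line's
`EllipticStabilisation` from the first. [cite: Rogawski1990, Thm. 14.5.1 (a) p. 238; §14.5 pp. 240–241] -/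
theorem finsum_eq_finsum_add_mul_finsum_of_forall_eq (T : CH → CG → Prop) (t : CH → CG) (hT : ∀ c' c, T c' c ↔ t c' = c) (i : R)
    (J S : CG → R) (SJH : CH → R) (hJ : (Function.support J).Finite) (hSJH : (Function.support SJH).Finite)
    (h : ∀ c, J c = S c + i * ∑ᶠ c' : {c' : CH // T c' c}, SJH c'.1) :
    ∑ᶠ c, J c = ∑ᶠ c, S c + i * ∑ᶠ c', SJH c' := by
  have hE : (Function.support fun c => i * ∑ᶠ c' : {c' : CH // T c' c}, SJH c'.1).Finite :=
    (finite_support_finsum_subtype_of_iff T t hT SJH hSJH).subset (Function.support_mul_subset_right _ _)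
  -- `S = J − i·E` is finitely supported
  have hS : (Function.support S).Finite := by
    refine (hJ.union hE).subset fun c hc => ?_
    rw [Function.mem_support] at hc
    by_contra hc'
    rw [Set.mem_union, Function.mem_support, Function.mem_support, not_or, not_not, not_not] at hc'
    apply hc
    have h1 := h c
    rw [hc'.1, hc'.2, add_zero] at h1
    exact h1.symm
  rw [finsum_congr h, finsum_add_distrib hS hE, ← mul_finsum' _ _ (finite_support_finsum_subtype_of_iff T t hT SJH hSJH),
    finsum_finsum_subtype_eq_finsum_of_iff T t hT SJH hSJH]

/-- The same with the stable part written through ★ `stabilize`: `Σᶠ_c J c = Σᶠ_c stabilize T i J SJH c + i · Σᶠ_{c′} SJH c′` (finitely supported `J`, `SJH`;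
`T` the graph of `t`). [cite: Rogawski1990, §10.1 p. 146; §14.5 pp. 240–241] -/
theorem finsum_eq_finsum_stabilize_add_mul_finsum (T : CH → CG → Prop) (t : CH → CG) (hT : ∀ c' c, T c' c ↔ t c' = c) (i : ℂ)
    (J : CG → ℂ) (SJH : CH → ℂ) (hJ : (Function.support J).Finite) (hSJH : (Function.support SJH).Finite) :
    ∑ᶠ c, J c = ∑ᶠ c, stabilize T i J SJH c + i * ∑ᶠ c', SJH c' :=
  finsum_eq_finsum_add_mul_finsum_of_forall_eq T t hT i J (stabilize T i J SJH) SJH hJ hSJH (eq_stabilize_add T i J SJH)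

end Law

end Literature.NumberTheory.Rogawski1990
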